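import Summits.Ventures.CertifiedManyBodySolver.Observables.RungLeavesPairAnchor
import Literature.MathematicalPhysics.QuantumLattice.TwistedSpaceGroupUnitary
import HarnessLib

/-!
# Ventures/CertifiedManyBodySolver — Observables/PairLROOnePointTwisted.lean

HONEST FRAMING: first certified bounds on pairing observables; a one-point CEILING route — a ceiling never
speaks to the presence of pairing; not a superconductivity verdict; nothing in this file is a number.

Cell `hubbard-obs` (D-0042), seat p1, `prover-hubbard-obs-p1-g7-0`. **W8 «TwistedOrbitFamily» — the reading
and the consumer** (PAIRCORR-SDP §13.14 (T5)–(T6); Literature side: `FockGaugeRotation`,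
`TwistedSpaceGroupUnitary`, `HubbardNNNHoppingTwistedWindowCertificate`). eng-2's node-grade one-point objects
are built under the TWISTED identification (the `b₁g`-odd lattice elements composed with the gauge quarter
turn `c ↦ i c`; ×3.8 fewer variables than the `D₂` export) and had to be TRANSPLANTED to a `D₂` object to be
readable (`re_orbitState_spaceGroupUnitary_localPairAt` needs `b1gSign = 1` on the point group). This file
removes that restriction:

* `fockGauge_conj_of_totalNumberOp_commutator` — a charge-`q` torus operator (`[N̂, A] = qA`) is conjugated
  by the gauge unitary `𝒢_k` to `i^{kq} A`; `fockGauge_conj_localPair` — the local `d`-wave pair picks up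
  `(−1)^k`;
* `re_orbitState_twistedSpaceGroupUnitary_localPairAt` — for EVERY nonempty `S ⊆ D₄` (no `b1gSign`
  hypothesis) the twisted orbit state of a unit vector `ζ` evaluates the pulled-back local `d`-wave pair at
  the origin to `Re⟨ζ, Δ_d ζ⟩/L²` (the two signs `b1gSign γ` — from rotating the form factor — and
  `(−1)^{j(γ)}` — from the gauge twist — cancel);
* `ObsPairLROCeilingAt_of_onePoint_twisted_orbitState_bound_sq` — the registry consumer: a TWISTED OP1-E
  claim node (the orbit-state inequality of the node files with `orbitState (twistedSpaceGroupUnitary S)`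
  in place of `orbitState (spaceGroupUnitary S)`, any `S ∋` anything, closed or not) at the anchor
  `(U, n, t′)` with cap `e₀ ≤ hi ≤ u`, `κ ≥ 0`, `0 ≤ U`, `0 ≤ n < 2` gives `ObsPairLROCeilingAt tp U n c'` at
  every `c' ≥ (c − A + (Σμ)(n/2 − ν))²` (Koma–Tasaki tower constant), and `…_reprice` its fast layer.

No named fact, zero computation, no `sorry`; CONDITIONAL on the claim node fed in.
References: T. Koma, H. Tasaki, J. Stat. Phys. 76 (1994) 745, Theorem 5 [KomaTasaki1994]; O. Bratteli,
D. W. Robinson, *Operator Algebras and Quantum Statistical Mechanics 2*, §5.2.2 [BratteliRobinsonII1997];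
D. J. Scalapino, Phys. Rep. 250 (1995) 329, §2 eq. (2.3) [Scalapino1995].
-/

noncomputable section

namespace Summit.Ventures.CertifiedManyBodySolver.Observables

open Matrix Complex Literature.MathematicalPhysics.QuantumLattice Literature.Probability.LatticeModels
open Literature.MathematicalPhysics.QuantumLattice.HubbardWave0 ThermodynamicLimit Filter Topology
open Literature.MathematicalPhysics.QuantumManyBody.StateRelaxation
open Summit.Ventures.CertifiedManyBodySolver.Transport
open scoped ComplexOrder ComplexConjugate BigOperators

/-! ### §1 Gauge conjugation of a charge-`q` operator -/

section Charge

variable {ι : Type*} [Fintype ι] [LinearOrder ι]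

omit [Fintype ι] [LinearOrder ι] in
/-- `i^{3n} = i^{-n}` as an integer power. [cite: BratteliRobinsonII1997, §5.2.2] -/
private theorem I_pow_three_mul_eq_zpow_neg' (n : ℕ) : I ^ (3 * n) = I ^ (-(n : ℤ)) := by
  rw [_root_.zpow_neg, zpow_natCast, ← inv_pow, inv_I, ← I_pow_three, ← pow_mul]

/-- **A charge-`q` operator is conjugated by `𝒢_k` to `i^{kq}` times itself**: if `N̂A − AN̂ = q·A` then
`𝒢_k A 𝒢_kᴴ = i^{kq} · A` (`q ∈ ℤ`). [cite: BratteliRobinsonII1997, §5.2.2] -/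
theorem fockGauge_conj_of_totalNumberOp_commutator {A : Matrix (Finset ι) (Finset ι) ℂ} {q : ℤ}
    (hA : totalNumberOp * A - A * totalNumberOp = (q : ℂ) • A) (k : ℕ) :
    fockGauge k * A * (fockGauge k)ᴴ = (I ^ ((k : ℤ) * q)) • A := by
  have hst : ∀ s t : Finset ι, A s t ≠ 0 → ((s.card : ℤ) - (t.card : ℤ) : ℤ) = q := by
    intro s t hne
    have h := congr_fun (congr_fun hA s) t
    rw [Matrix.sub_apply, totalNumberOp_eq_diagonal, diagonal_mul, mul_diagonal, Matrix.smul_apply, smul_eq_mul,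
      mul_comm (A s t), ← sub_mul] at h
    have h' : ((s.card : ℂ) - (t.card : ℂ)) = (q : ℂ) := mul_right_cancel₀ hne h
    exact_mod_cast h'
  ext s t
  rw [conjTranspose_fockGauge]
  simp only [fockGauge, mul_diagonal, diagonal_mul, Matrix.smul_apply, smul_eq_mul]
  by_cases hne : A s t = 0
  · rw [hne, mul_zero, zero_mul, mul_zero]
  · have hq := hst s t hne
    have hph : I ^ (k * s.card) * I ^ (3 * k * t.card) = I ^ ((k : ℤ) * q) := by
      rw [mul_assoc 3 k, I_pow_three_mul_eq_zpow_neg', ← zpow_natCast, ← zpow_add₀ I_ne_zero, ← hq]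
      congr 1
      push_cast
      ring
    calc I ^ (k * s.card) * A s t * I ^ (3 * k * t.card) = I ^ (k * s.card) * I ^ (3 * k * t.card) * A s t := by ring
      _ = I ^ ((k : ℤ) * q) * A s t := by rw [hph]

end Charge

section Torus

variable {L : ℕ} [NeZero L] (g : Site 2 → ℝ)

/-- **The local pair has charge `−2`, hence `𝒢_k Φ_x 𝒢_kᴴ = (−1)^k Φ_x`.** [cite: BratteliRobinsonII1997, §5.2.2] -/
theorem fockGauge_conj_localPair (k : ℕ) (x : TorusSite 2 L) :
    fockGauge k * localPair g L x * (fockGauge k)ᴴ = ((-1 : ℂ) ^ k) • localPair g L x := by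
  have hA : totalNumberOp * localPair g L x - localPair g L x * totalNumberOp = ((-2 : ℤ) : ℂ) • localPair g L x := by
    rw [totalNumberOp_eq_totalNumber, totalNumber_commutator_localPair g L x]; norm_num
  rw [fockGauge_conj_of_totalNumberOp_commutator hA k,
    show ((k : ℤ) * -2) = -(((2 * k : ℕ) : ℤ)) by push_cast; ring, _root_.zpow_neg, zpow_natCast, pow_mul, I_sq,
    ← inv_pow, inv_neg, inv_one]

/-- `⟨Mᴴ φ, A Mᴴ φ⟩ = ⟨φ, M A Mᴴ φ⟩`. [folklore] -/
private theorem expect_conjTranspose_mulVec'' {ι : Type*} [LinearOrder ι] [Fintype ι]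
    (A M : Matrix (Finset ι) (Finset ι) ℂ) (φ : Fock ι) :
    expect A (Mᴴ *ᵥ φ) = expect (M * A * Mᴴ) φ := by
  unfold expect
  rw [star_mulVec, conjTranspose_conjTranspose, ← dotProduct_mulVec, mulVec_mulVec, mulVec_mulVec]

/-- The sign bookkeeping of the twist: `(−1)^{j(γ)+2m} · b1gSign γ = 1`. [cite: Scalapino1995, §2 eq. (2.3)] -/
theorem neg_one_pow_twistExp_mul_b1gSign (γ : DihedralGroup 4) (m : Fin 2) :
    ((-1 : ℂ) ^ twistExp γ m) * ((b1gSign γ : ℝ) : ℂ) = 1 := by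
  rw [b1gSign_eq_neg_one_pow_b1gTwist, twistExp, pow_add, pow_mul]
  push_cast
  rw [neg_one_sq, one_pow, mul_one, ← pow_add, ← two_mul, pow_mul, neg_one_sq, one_pow]

/-- **The twisted orbit state reads the `d`-wave one-point amplitude for EVERY point group `S ⊆ D₄`.**
For `S ≠ ∅`, a window `Λ' ⊇ pairRegion {0,±e₁,±e₂} 0` fitting into the torus and any vector `ζ`:
`Re ω̄^{tw,S}_ζ(Γ(ι_{Λ'}) Γ(incl) Φ₀^{d}) = Re⟨ζ, Δ_d ζ⟩/L²` — the `B₁g` sign of each `γ` (from rotating the form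
factor) is cancelled by the gauge twist `(−1)^{j(γ)}` (from `𝒢 Φ 𝒢ᴴ = −Φ`), so no `b1gSign = 1` restriction is
needed (contrast `re_orbitState_spaceGroupUnitary_localPairAt`). [cite: KomaTasaki1994, Theorem 5]
[cite: Scalapino1995, §2 eq. (2.3)] -/
theorem re_orbitState_twistedSpaceGroupUnitary_localPairAt {S : Finset (DihedralGroup 4)} (hS : S.Nonempty)
    {Λ' : Finset (Site 2)} (h0 : pairRegion (insert (0 : Site 2) unitSteps) 0 ⊆ Λ')
    (hInj' : Set.InjOn (Torus.proj (d := 2) L) ↑Λ') (ζ : Fock (Orb (FermionTorus 2 L))) :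
    (orbitState (twistedSpaceGroupUnitary S) ζ (fermionEmbed (PolySite.toTorusEmb L hInj')
        (fermionEmbed (PolySite.incl h0) (localPairAt (insert (0 : Site 2) unitSteps) dWaveFormFactor 0)))).re =
      (expect (pairField dWaveFormFactor L) ζ).re / (L : ℝ) ^ 2 := by
  haveI : Nonempty ↥S := ⟨⟨hS.choose, hS.choose_spec⟩⟩
  have hInj0 : Set.InjOn (Torus.proj (d := 2) L) ↑(pairRegion (insert (0 : Site 2) unitSteps) 0) :=
    hInj'.mono (by exact_mod_cast h0)
  have hproj0 : Torus.proj L (0 : Site 2) = (0 : TorusSite 2 L) := by funext i; simp [Torus.proj]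
  -- the pulled-back local pair IS the torus local pair at the origin
  have hP0 : fermionEmbed (PolySite.toTorusEmb L hInj')
      (fermionEmbed (PolySite.incl h0) (localPairAt (insert (0 : Site 2) unitSteps) dWaveFormFactor 0)) =
      localPair dWaveFormFactor L 0 := by
    rw [fermionEmbed_toTorusEmb_incl h0 hInj', fermionEmbed_toTorusEmb_localPairAt L _ dWaveFormFactor 0 hInj0,
      hproj0, localPairOn_insert_zero_unitSteps]
  -- each member of the twisted family contributes `⟨ζ, Φ_{γ0+v} ζ⟩`
  have hterm : ∀ gm : (TorusSite 2 L × ↥S) × Fin 2,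
      Literature.MathematicalPhysics.QuantumManyBody.StateRelaxation.vectorState ((twistedSpaceGroupUnitary S gm)ᴴ *ᵥ ζ) (localPair dWaveFormFactor L 0) =
        expect (localPair dWaveFormFactor L (d4Site (gm.1.2 : DihedralGroup 4) 0 + gm.1.1)) ζ := by
    rintro ⟨⟨v, γ, hγ⟩, m⟩
    rw [Literature.MathematicalPhysics.QuantumManyBody.StateRelaxation.vectorState_apply, show star ((twistedSpaceGroupUnitary S ((v, ⟨γ, hγ⟩), m))ᴴ *ᵥ ζ) ⬝ᵥ
        localPair dWaveFormFactor L 0 *ᵥ ((twistedSpaceGroupUnitary S ((v, ⟨γ, hγ⟩), m))ᴴ *ᵥ ζ) =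
        expect (localPair dWaveFormFactor L 0) ((twistedSpaceGroupUnitary S ((v, ⟨γ, hγ⟩), m))ᴴ *ᵥ ζ) from rfl,
      expect_conjTranspose_mulVec'', twistedSpaceGroupUnitary_apply]
    -- gauge factor innermost
    have hconj : spaceGroupUnitary S (v, ⟨γ, hγ⟩) * fockGauge (twistExp γ m) * localPair dWaveFormFactor L 0 *
        (spaceGroupUnitary S (v, ⟨γ, hγ⟩) * fockGauge (twistExp γ m))ᴴ =
        localPair dWaveFormFactor L (d4Site γ 0 + v) := by
      rw [conjTranspose_mul,
        show spaceGroupUnitary S (v, ⟨γ, hγ⟩) * fockGauge (twistExp γ m) * localPair dWaveFormFactor L 0 *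
            ((fockGauge (twistExp γ m))ᴴ * (spaceGroupUnitary S (v, ⟨γ, hγ⟩))ᴴ) =
          spaceGroupUnitary S (v, ⟨γ, hγ⟩) *
            (fockGauge (twistExp γ m) * localPair dWaveFormFactor L 0 * (fockGauge (twistExp γ m))ᴴ) *
            (spaceGroupUnitary S (v, ⟨γ, hγ⟩))ᴴ by simp only [Matrix.mul_assoc],
        fockGauge_conj_localPair, Matrix.mul_smul, Matrix.smul_mul,
        show spaceGroupUnitary S (v, ⟨γ, hγ⟩) * localPair dWaveFormFactor L 0 * (spaceGroupUnitary S (v, ⟨γ, hγ⟩))ᴴ =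
          (fockTranslate v).val * (fockD4 (L := L) γ).val * localPair dWaveFormFactor L 0 *
            ((fockTranslate v).val * (fockD4 (L := L) γ).val)ᴴ from rfl,
        d4Affine_conj, relabel_d4Perm_localPair_of_parity γ dWaveFormFactor (b1gSign γ) (b1gSign_mul_self γ)
          (dWaveFormFactor_d4Vec_eq_b1gSign_mul γ),
        relabel_smul, relabel_translate_localPair, smul_smul, neg_one_pow_twistExp_mul_b1gSign, one_smul]
    simp only at hconj ⊢
    rw [hconj]
  -- sum over the family
  rw [hP0, orbitState_apply, Fintype.sum_congr _ _ hterm, Fintype.sum_prod_type, Fintype.sum_prod_type]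
  simp only [Finset.sum_const, Finset.card_univ, Fintype.card_fin, nsmul_eq_mul]
  have hinner : ∀ γ' : ↥S, ∑ v : TorusSite 2 L,
      expect (localPair dWaveFormFactor L (d4Site (γ' : DihedralGroup 4) 0 + v)) ζ =
        expect (pairField dWaveFormFactor L) ζ := by
    intro γ'
    rw [pairField, expect_sum]
    exact Fintype.sum_equiv (Equiv.addLeft (d4Site (γ' : DihedralGroup 4) 0)) _ _ fun v => rfl
  rw [Finset.sum_comm]
  simp_rw [← Finset.mul_sum, hinner, Finset.sum_const, Finset.card_univ, nsmul_eq_mul]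
  rw [Fintype.card_prod, Fintype.card_prod, card_torusSite, Fintype.card_coe, Fintype.card_fin]
  have hS0 : (S.card : ℂ) ≠ 0 := Nat.cast_ne_zero.2 (Finset.card_pos.2 hS).ne'
  have hL0 : ((L ^ 2 : ℕ) : ℂ) ≠ 0 := by exact_mod_cast pow_ne_zero 2 (NeZero.ne L)
  have hL2 : ((L : ℂ)) ^ 2 ≠ 0 := pow_ne_zero 2 (Nat.cast_ne_zero.2 (NeZero.ne L))
  have key : (((L ^ 2 * S.card * 2 : ℕ) : ℂ))⁻¹ * (((2 : ℕ) : ℂ) * ((S.card : ℂ) * expect (pairField dWaveFormFactor L) ζ)) =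
      expect (pairField dWaveFormFactor L) ζ / ((((L : ℝ) ^ 2 : ℝ)) : ℂ) := by
    push_cast
    field_simp
  rw [key, Complex.div_ofReal_re]

end Torus

/-! ### §3 The registry consumer for TWISTED one-point nodes, any anchor -/

section Consumer

variable {tp U n : ℝ} {hi c' : ℚ} {c A κ u ν : ℝ}

/-- **Twisted OP1-E orbit-state node at `(U, n, t′)` ⇒ the leaf at the sharp (Koma–Tasaki tower) constant `M²`.**
As `ObsPairLROCeilingAt_of_onePoint_orbitState_bound_sq` (RungLeavesPairAnchor) but with the TWISTED orbit state
`orbitState (twistedSpaceGroupUnitary S)` in the node inequality and NO `b1gSign` hypothesis on `S ≠ ∅`.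
[cite: KomaTasaki1994, Theorem 5] -/
theorem ObsPairLROCeilingAt_of_onePoint_twisted_orbitState_bound_sq (hU : 0 ≤ U) (hn0 : 0 ≤ n) (hn2 : n < 2)
    (μ : Fin 2 → ℝ) (hκ : 0 ≤ κ) (hE : energyDensityTT' 1 tp U n ≤ ((hi : ℚ) : ℝ)) (hhi : ((hi : ℚ) : ℝ) ≤ u)
    {S : Finset (DihedralGroup 4)} (hS : S.Nonempty)
    {Λ' : Finset (Site 2)} (h0 : pairRegion (insert (0 : Site 2) unitSteps) 0 ⊆ Λ') (L₁ : ℕ)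
    (hInj : ∀ L : ℕ, L₁ ≤ L → Set.InjOn (Torus.proj (d := 2) L) ↑Λ')
    (hbound : ∀ (L : ℕ) [NeZero L] (hL : L₁ ≤ L) (ζ : Fock (Orb (FermionTorus 2 L))), star ζ ⬝ᵥ ζ = 1 →
      c - A + ∑ σ : Fin 2, μ σ *
          ((star ζ ⬝ᵥ ((∑ y : FermionTorus 2 L, numberOp y σ) *ᵥ ζ)).re / (L : ℝ) ^ 2 - ν) +
        κ * (u - (star ζ ⬝ᵥ (hubbardTorusTT' L 1 tp U *ᵥ ζ)).re / (L : ℝ) ^ 2) ≤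
        (orbitState (twistedSpaceGroupUnitary S) ζ (fermionEmbed (PolySite.toTorusEmb L (hInj L hL))
          (-(fermionEmbed (PolySite.incl h0)
            (localPairAt (insert (0 : Site 2) unitSteps) dWaveFormFactor 0))))).re)
    (hc' : (c - A + (∑ σ : Fin 2, μ σ) * (n / 2 - ν)) ^ 2 ≤ ((c' : ℚ) : ℝ)) :
    ObsPairLROCeilingAt tp U n c' := by
  intro ψ hψ hψ1
  refine (liminf_pairFieldLRO_le_sq_of_onePoint_variational_bound_TT' dWaveFormFactor 1 tp hU hn0 hn2 μ hκ
    (hE.trans hhi) L₁ ?_ ψ hψ hψ1).trans hc'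
  intro L _ hL ζ hζ
  have h := hbound L hL ζ hζ
  rwa [fermionEmbed_neg, map_neg, Complex.neg_re, re_orbitState_twistedSpaceGroupUnitary_localPairAt hS h0 (hInj L hL) ζ]
    at h

/-- **THE ONE-POINT FAST LAYER for twisted nodes.** The same node read under ANY certified cap `e₀ ≤ hi` gives the
leaf at every `c' ≥ (c − A + (Σμ)(n/2 − ν) + κ(u − hi))²`. [cite: KomaTasaki1994, Theorem 5] -/
theorem ObsPairLROCeilingAt_of_onePoint_twisted_orbitState_bound_sq_reprice (hU : 0 ≤ U) (hn0 : 0 ≤ n) (hn2 : n < 2)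
    (μ : Fin 2 → ℝ) (hκ : 0 ≤ κ) (hE : energyDensityTT' 1 tp U n ≤ ((hi : ℚ) : ℝ))
    {S : Finset (DihedralGroup 4)} (hS : S.Nonempty)
    {Λ' : Finset (Site 2)} (h0 : pairRegion (insert (0 : Site 2) unitSteps) 0 ⊆ Λ') (L₁ : ℕ)
    (hInj : ∀ L : ℕ, L₁ ≤ L → Set.InjOn (Torus.proj (d := 2) L) ↑Λ')
    (hbound : ∀ (L : ℕ) [NeZero L] (hL : L₁ ≤ L) (ζ : Fock (Orb (FermionTorus 2 L))), star ζ ⬝ᵥ ζ = 1 →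
      c - A + ∑ σ : Fin 2, μ σ *
          ((star ζ ⬝ᵥ ((∑ y : FermionTorus 2 L, numberOp y σ) *ᵥ ζ)).re / (L : ℝ) ^ 2 - ν) +
        κ * (u - (star ζ ⬝ᵥ (hubbardTorusTT' L 1 tp U *ᵥ ζ)).re / (L : ℝ) ^ 2) ≤
        (orbitState (twistedSpaceGroupUnitary S) ζ (fermionEmbed (PolySite.toTorusEmb L (hInj L hL))
          (-(fermionEmbed (PolySite.incl h0)
            (localPairAt (insert (0 : Site 2) unitSteps) dWaveFormFactor 0))))).re)
    (hc' : (c - A + (∑ σ : Fin 2, μ σ) * (n / 2 - ν) + κ * (u - ((hi : ℚ) : ℝ))) ^ 2 ≤ ((c' : ℚ) : ℝ)) :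
    ObsPairLROCeilingAt tp U n c' := by
  have hc'' : (c + κ * (u - ((hi : ℚ) : ℝ)) - A + (∑ σ : Fin 2, μ σ) * (n / 2 - ν)) ^ 2 ≤ ((c' : ℚ) : ℝ) := by
    have : c + κ * (u - ((hi : ℚ) : ℝ)) - A + (∑ σ : Fin 2, μ σ) * (n / 2 - ν) =
        c - A + (∑ σ : Fin 2, μ σ) * (n / 2 - ν) + κ * (u - ((hi : ℚ) : ℝ)) := by ring
    rw [this]; exact hc'
  refine ObsPairLROCeilingAt_of_onePoint_twisted_orbitState_bound_sq (c := c + κ * (u - ((hi : ℚ) : ℝ)))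
    (u := ((hi : ℚ) : ℝ)) hU hn0 hn2 μ hκ hE le_rfl hS h0 L₁ hInj ?_ hc''
  intro L _ hL ζ hζ
  convert hbound L hL ζ hζ using 1
  ring

end Consumer

end Summit.Ventures.CertifiedManyBodySolver.Observables

end
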